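import Summits.HubbardSuperconductivity.HubbardSuperconductivity.Theorems.DWavePolarisedDiscordance.Negative.FalseWithoutMinimality
import Summits.HubbardSuperconductivity.HubbardSuperconductivity.Theorems.ThermalWedgeTwSeededEnsembleEquivalenceBarrierPauliBlocking

/-!
# Crux `DWavePolarisedDiscordance` (K3′, stmt-HubbardSuperconductivity-15314, route `LiebTwin`) —
# negative-side toolkit IV: bond pair orders of doublon sums are `O(n)` (locality + disjoint supports)

Support for `StubMassFeedsBondSingletsFalseWithoutMinimality` (the bond-locality form K3″ of the crux — stub
`stub_massFeedsBondSinglets` of line `registered`, the planned restatement K3′ := K3″ — is also false without the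
bottom-of-spectrum clause). For a pair field `Δ_g` with no on-site component (`g 0 = 0`) on the torus of side
`L ≥ 2` and a doublon sum `ψ_w = Σ_{S ∈ 𝒮} w_S |S↑ ∪ S↓⟩`:

* `localPair_mulVec_single_pairSet_apply_ne_zero` — a nonzero amplitude `(P_x |S↑∪S↓⟩)(u)` forces
  `u = (S↑∪S↓) ∖ {i, j}` for two orbitals at DISTINCT sites, one of them the site of `x`;
* `card_filter_localPair_apply_ne_zero_le_two` — hence at most TWO local pair operators `P_x` contribute to a
  given amplitude `u` (the two deficient sites of `u`);
* `sum_norm_sq_pairField_mulVec_single_pairSet_le` — `‖Δ_g |S↑∪S↓⟩‖² ≤ 2 C_g² #S`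
  (`C_g = Σ_e 2|g e|/√2`, the tree's crude bound for `‖P_x‖`; only the `#S` operators `P_x` with `x ∈ S` act);
* `re_expect_pairField_doublonSum_le` — `F_g(ψ_w) ≤ 2 C_g² Σ_S #S ‖w_S‖²`: bond pair order of a doublon sum is
  `O(n)·‖ψ_w‖²`, three orders below the `L⁴` scale of K3′/K3″ (contrast: the on-site order of the unstaggered sum
  is Yang's `2n(L²-n+1)‖ψ‖²`).

Sources: C. N. Yang, PRL **63** (1989) 2144; D. J. Scalapino, Phys. Rep. **250** (1995) 329, §2, eq. (2.2);
O. Bratteli, D. W. Robinson, *Operator Algebras and QSM 2*, §5.2.2 (CAR contractions). Elementary; no definition.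
-/

noncomputable section

-- the mandated namespace repeats `HubbardSuperconductivity` (single-problem summit, D-0017)
set_option linter.dupNamespace false

namespace Summit.HubbardSuperconductivity.HubbardSuperconductivity.Theorems.DWavePolarisedDiscordance.Negative

open Matrix Finset Literature.MathematicalPhysics.QuantumLattice Literature.Probability.LatticeModels
open Summit.HubbardSuperconductivity.HubbardSuperconductivity.Theorems.IsoperimetricCascade (mem_pairSet_self)
open Summit.HubbardSuperconductivity.HubbardSuperconductivity.Theorems.TwSeededEnsembleEquivalence.ExposedDensity.SWavePairFluctuation
  (re_star_dotProduct_self)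
open scoped ComplexOrder

section BondBound

/-- Cauchy–Schwarz with multiplicity: `‖Σ_{x ∈ s} f x‖² ≤ #{x ∈ s : f x ≠ 0} · Σ_{x ∈ s} ‖f x‖²`. [folklore] -/
theorem norm_sq_sum_le_card_filter_mul {ι : Type*} [DecidableEq ι] (s : Finset ι) (f : ι → ℂ) :
    ‖∑ x ∈ s, f x‖ ^ 2 ≤ ((s.filter fun x => f x ≠ 0).card : ℝ) * ∑ x ∈ s, ‖f x‖ ^ 2 := by
  rw [← Finset.sum_filter_ne_zero s]
  calc ‖∑ x ∈ s.filter (fun x => f x ≠ 0), f x‖ ^ 2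
      ≤ (∑ x ∈ s.filter (fun x => f x ≠ 0), ‖f x‖) ^ 2 :=
        pow_le_pow_left₀ (norm_nonneg _) (norm_sum_le _ _) 2
    _ ≤ ((s.filter fun x => f x ≠ 0).card : ℝ) * ∑ x ∈ s.filter (fun x => f x ≠ 0), ‖f x‖ ^ 2 :=
        sq_sum_le_card_mul_sum_sq
    _ ≤ ((s.filter fun x => f x ≠ 0).card : ℝ) * ∑ x ∈ s, ‖f x‖ ^ 2 :=
        mul_le_mul_of_nonneg_left
          (Finset.sum_le_sum_of_subset_of_nonneg (filter_subset _ _) fun _ _ _ => by positivity)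
          (Nat.cast_nonneg _)

variable {Λ : Type*} [LinearOrder Λ] [Fintype Λ] [DecidableEq Λ]

/-- A nonzero amplitude of two annihilations on a basis vector pins the configuration:
`(c_i c_j |s⟩)(u) ≠ 0 ⟹ j ∈ s, i ∈ s ∖ j, u = s ∖ {j, i}`. Essler et al. (2005) §2.1. [folklore] -/
theorem eq_erase_erase_of_annihilation_mul_annihilation_apply_ne_zero {i j : Orb Λ} {s u : Finset (Orb Λ)}
    (h : ((annihilation i * annihilation j) *ᵥ Pi.single s (1 : ℂ)) u ≠ 0) :
    j ∈ s ∧ i ∈ s.erase j ∧ u = (s.erase j).erase i := by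
  rw [← mulVec_mulVec, annihilation_mulVec_single'] at h
  by_cases hj : j ∈ s
  · rw [if_pos hj, mulVec_smul, annihilation_mulVec_single'] at h
    by_cases hi : i ∈ s.erase j
    · rw [if_pos hi, Pi.smul_apply, Pi.smul_apply, Pi.single_apply] at h
      by_cases hu : u = (s.erase j).erase i
      · exact ⟨hj, hi, hu⟩
      · rw [if_neg hu, smul_zero, smul_zero] at h
        exact absurd rfl h
    · rw [if_neg hi, smul_zero, Pi.zero_apply] at h
      exact absurd rfl h
  · rw [if_neg hj, mulVec_zero, Pi.zero_apply] at h
    exact absurd rfl h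

variable {L : ℕ} [NeZero L]

/-- **Locality of the local pair operator on doublon configurations.** If `(P_x |S↑ ∪ S↓⟩)(u) ≠ 0` for a pair
field with no on-site component (`g 0 = 0`, `L ≥ 2`), then `u = (S↑∪S↓) ∖ {j} ∖ {i}` for orbitals `i, j` at two
DISTINCT sites, one of which is the site of `x`. Scalapino, Phys. Rep. 250 (1995) 329, §2, eq. (2.2). [folklore] -/
theorem localPair_mulVec_single_pairSet_apply_ne_zero [Fact (1 < L)] {g : Site 2 → ℝ} (hg : g 0 = 0)
    (x : TorusSite 2 L) (S : Finset (FermionTorus 2 L)) {u : Finset (Orb (FermionTorus 2 L))}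
    (hu : (localPair g L x *ᵥ Pi.single (pairSet S S) (1 : ℂ)) u ≠ 0) :
    ∃ i j : Orb (FermionTorus 2 L), (ofLex i).1 ≠ (ofLex j).1 ∧
      ((ofLex i).1 = FermionTorus.ofTorusSite x ∨ (ofLex j).1 = FermionTorus.ofTorusSite x) ∧
      j ∈ pairSet S S ∧ i ∈ (pairSet S S).erase j ∧ u = ((pairSet S S).erase j).erase i := by
  unfold localPair at hu
  rw [sum_mulVec, Finset.sum_apply] at hu
  obtain ⟨e, he, hne⟩ := Finset.exists_ne_zero_of_sum_ne_zero hu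
  rw [smul_mulVec, Pi.smul_apply, sub_mulVec, Pi.sub_apply] at hne
  rcases Finset.mem_insert.1 he with rfl | he'
  · rw [hg, zero_div, Complex.ofReal_zero, zero_smul] at hne
    exact absurd rfl hne
  · have hxy := ofTorusSite_ne_ofTorusSite_add x he'
    have hsub : ((annihilation (orb (FermionTorus.ofTorusSite x) 0) *
          annihilation (orb (FermionTorus.ofTorusSite (x + Torus.proj L e)) 1)) *ᵥ
            Pi.single (pairSet S S) (1 : ℂ)) u -
        ((annihilation (orb (FermionTorus.ofTorusSite x) 1) *
          annihilation (orb (FermionTorus.ofTorusSite (x + Torus.proj L e)) 0)) *ᵥ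
            Pi.single (pairSet S S) (1 : ℂ)) u ≠ 0 := by
      intro h0
      rw [h0, smul_zero] at hne
      exact hne rfl
    by_cases h1 : ((annihilation (orb (FermionTorus.ofTorusSite x) 0) *
          annihilation (orb (FermionTorus.ofTorusSite (x + Torus.proj L e)) 1)) *ᵥ
            Pi.single (pairSet S S) (1 : ℂ)) u = 0
    · rw [h1, zero_sub, neg_ne_zero] at hsub
      obtain ⟨hj, hi, hu'⟩ := eq_erase_erase_of_annihilation_mul_annihilation_apply_ne_zero hsub
      exact ⟨_, _, by simpa [orb] using hxy, Or.inl (by simp [orb]), hj, hi, hu'⟩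
    · obtain ⟨hj, hi, hu'⟩ := eq_erase_erase_of_annihilation_mul_annihilation_apply_ne_zero h1
      exact ⟨_, _, by simpa [orb] using hxy, Or.inl (by simp [orb]), hj, hi, hu'⟩

/-- **At most two local pair operators feed a given amplitude.** For `g 0 = 0`, `L ≥ 2` and any `u`,
`#{x : (P_x |S↑∪S↓⟩)(u) ≠ 0} ≤ 2` (such an `x` is one of the two deficient sites of `u`). [folklore] -/
theorem card_filter_localPair_apply_ne_zero_le_two [Fact (1 < L)] {g : Site 2 → ℝ} (hg : g 0 = 0)
    (S : Finset (FermionTorus 2 L)) (u : Finset (Orb (FermionTorus 2 L))) :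
    (univ.filter fun x : TorusSite 2 L =>
        (localPair g L x *ᵥ Pi.single (pairSet S S) (1 : ℂ)) u ≠ 0).card ≤ 2 := by
  rcases (univ.filter fun x : TorusSite 2 L =>
      (localPair g L x *ᵥ Pi.single (pairSet S S) (1 : ℂ)) u ≠ 0).eq_empty_or_nonempty with h0 | ⟨x₀, hx₀⟩
  · rw [h0, card_empty]
    exact Nat.zero_le _
  · obtain ⟨i, j, -, -, hj, hi, hu⟩ :=
      localPair_mulVec_single_pairSet_apply_ne_zero hg x₀ S (mem_filter.1 hx₀).2
    -- an orbital of `S↑∪S↓` missing from `u` is `i` or `j`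
    have hmiss : ∀ o ∈ pairSet S S, o ∉ u → (ofLex o).1 = (ofLex i).1 ∨ (ofLex o).1 = (ofLex j).1 := by
      intro o ho hou
      rw [hu] at hou
      simp only [mem_erase, not_and] at hou
      by_cases hoi : o = i
      · exact Or.inl (by rw [hoi])
      · by_cases hoj : o = j
        · exact Or.inr (by rw [hoj])
        · exact absurd ho (hou hoi hoj)
    -- every contributing `x` sits at the site of `i` or of `j`
    have key : ∀ x ∈ univ.filter (fun x : TorusSite 2 L =>
        (localPair g L x *ᵥ Pi.single (pairSet S S) (1 : ℂ)) u ≠ 0),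
        x ∈ ({FermionTorus.toTorusSite (ofLex i).1, FermionTorus.toTorusSite (ofLex j).1} :
          Finset (TorusSite 2 L)) := by
      intro x hx
      obtain ⟨i', j', -, hx', hj', hi', hu'⟩ :=
        localPair_mulVec_single_pairSet_apply_ne_zero hg x S (mem_filter.1 hx).2
      have hi'P : i' ∈ pairSet S S := mem_of_mem_erase hi'
      have hi'u : i' ∉ u := by rw [hu']; exact notMem_erase _ _
      have hj'u : j' ∉ u := by
        rw [hu']
        exact fun h => notMem_erase j' (pairSet S S) (mem_of_mem_erase h)
      have hX : FermionTorus.ofTorusSite x = (ofLex i).1 ∨ FermionTorus.ofTorusSite x = (ofLex j).1 := by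
        rcases hx' with h | h
        · rw [← h]; exact hmiss i' hi'P hi'u
        · rw [← h]; exact hmiss j' hj' hj'u
      rw [mem_insert, mem_singleton]
      rcases hX with h | h
      · left; rw [← h, FermionTorus.toTorusSite_ofTorusSite]
      · right; rw [← h, FermionTorus.toTorusSite_ofTorusSite]
    exact (card_le_card key).trans (card_insert_le _ _ |>.trans (by rw [card_singleton]))

/-- `‖ |s⟩ ‖² = 1` for an occupation basis vector. [folklore] -/
theorem star_single_dotProduct_single_one {ι : Type*} [DecidableEq ι] [Fintype ι] (s : ι) :
    star (Pi.single s (1 : ℂ)) ⬝ᵥ Pi.single s (1 : ℂ) = 1 := by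
  simp

/-- **Bond pair fields on one doublon configuration: `‖Δ_g |S↑∪S↓⟩‖² ≤ 2 C_g² #S`.** Only the `#S` local
operators `P_x`, `x ∈ S`, act (each bounded by `C_g = Σ_e 2|g e|/√2`), and at most two of them feed any given
amplitude. Scalapino, Phys. Rep. 250 (1995) 329, §2; Bratteli–Robinson II §5.2.2. [folklore] -/
theorem sum_norm_sq_pairField_mulVec_single_pairSet_le [Fact (1 < L)] {g : Site 2 → ℝ} (hg : g 0 = 0)
    (S : Finset (FermionTorus 2 L)) :
    ∑ u, ‖(pairField g L *ᵥ Pi.single (pairSet S S) (1 : ℂ)) u‖ ^ 2 ≤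
      2 * (∑ e ∈ insert 0 unitSteps, ‖((g e / Real.sqrt 2 : ℝ) : ℂ)‖ * 2) ^ 2 * S.card := by
  set C : ℝ := ∑ e ∈ insert 0 unitSteps, ‖((g e / Real.sqrt 2 : ℝ) : ℂ)‖ * 2 with hC
  set v : TorusSite 2 L → Fock (Orb (FermionTorus 2 L)) :=
    fun x => localPair g L x *ᵥ Pi.single (pairSet S S) (1 : ℂ) with hv
  -- pointwise multiplicity bound
  have hpt : ∀ u, ‖(pairField g L *ᵥ Pi.single (pairSet S S) (1 : ℂ)) u‖ ^ 2 ≤ 2 * ∑ x, ‖v x u‖ ^ 2 := by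
    intro u
    have happ : (pairField g L *ᵥ Pi.single (pairSet S S) (1 : ℂ)) u = ∑ x, v x u := by
      rw [pairField, sum_mulVec, Finset.sum_apply]
    rw [happ]
    refine (norm_sq_sum_le_card_filter_mul _ _).trans ?_
    refine mul_le_mul_of_nonneg_right ?_ (Finset.sum_nonneg fun _ _ => by positivity)
    exact_mod_cast card_filter_localPair_apply_ne_zero_le_two hg S u
  -- each local operator: zero unless its site is in `S`, and bounded by `C_g` otherwise
  have hloc : ∀ x : TorusSite 2 L, ∑ u, ‖v x u‖ ^ 2 ≤ if FermionTorus.ofTorusSite x ∈ S then C ^ 2 else 0 := by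
    intro x
    split_ifs with hx
    · rw [← re_star_dotProduct_self, ← norm_toLp_sq_eq_re]
      have h := norm_toLp_localPair_mulVec_le g L x (Pi.single (pairSet S S) (1 : ℂ))
      have h1 : ‖(WithLp.toLp 2 (Pi.single (pairSet S S) (1 : ℂ)) :
          EuclideanSpace ℂ (Finset (Orb (FermionTorus 2 L))))‖ = 1 := by
        have h2 := norm_toLp_sq_eq_re (Pi.single (pairSet S S) (1 : ℂ))
        rw [star_single_dotProduct_single_one, Complex.one_re] at h2
        exact (pow_eq_one_iff_of_nonneg (norm_nonneg _) two_ne_zero).1 h2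
      rw [h1, mul_one] at h
      exact pow_le_pow_left₀ (norm_nonneg _) h 2
    · refine (Finset.sum_eq_zero fun u _ => ?_).le
      rw [sq_eq_zero_iff, norm_eq_zero]
      by_contra hne
      obtain ⟨i, j, -, hx', hj, hi, -⟩ := localPair_mulVec_single_pairSet_apply_ne_zero hg x S hne
      have hiS : (ofLex i).1 ∈ S := (mem_pairSet_self S i).1 (mem_of_mem_erase hi)
      have hjS : (ofLex j).1 ∈ S := (mem_pairSet_self S j).1 hj
      rcases hx' with h | h
      · exact hx (h ▸ hiS)
      · exact hx (h ▸ hjS)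
  -- count the sites of `S`
  have hcount : ∑ x : TorusSite 2 L, (if FermionTorus.ofTorusSite x ∈ S then C ^ 2 else 0) = C ^ 2 * S.card := by
    rw [← Finset.sum_filter, sum_const, nsmul_eq_mul, mul_comm]
    congr 2
    have hmap : (univ.filter fun x : TorusSite 2 L => FermionTorus.ofTorusSite x ∈ S) =
        S.map (FermionTorus.equivTorusSite (d := 2) (L := L)).toEmbedding := by
      ext x
      simp only [mem_filter, mem_univ, true_and, mem_map_equiv]
      rfl
    rw [hmap, card_map]
  calc ∑ u, ‖(pairField g L *ᵥ Pi.single (pairSet S S) (1 : ℂ)) u‖ ^ 2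
      ≤ ∑ u, 2 * ∑ x, ‖v x u‖ ^ 2 := Finset.sum_le_sum fun u _ => hpt u
    _ = 2 * ∑ x, ∑ u, ‖v x u‖ ^ 2 := by rw [← Finset.mul_sum, Finset.sum_comm]
    _ ≤ 2 * ∑ x : TorusSite 2 L, (if FermionTorus.ofTorusSite x ∈ S then C ^ 2 else 0) :=
        mul_le_mul_of_nonneg_left (Finset.sum_le_sum fun x _ => hloc x) (by norm_num)
    _ = 2 * C ^ 2 * S.card := by rw [hcount, mul_assoc]

/-- Inner products of doublon sums: `⟨ψ_w, ψ_{w'}⟩ = Σ_S conj(w_S) w'_S` (the `|S↑∪S↓⟩` are orthonormal). [folklore] -/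
theorem star_doublonSum_dotProduct_doublonSum (𝒮 : Finset (Finset Λ)) (w w' : Finset Λ → ℂ) :
    star (∑ S ∈ 𝒮, w S • Pi.single (pairSet S S) (1 : ℂ)) ⬝ᵥ
        (∑ S ∈ 𝒮, w' S • Pi.single (pairSet S S) (1 : ℂ)) = ∑ S ∈ 𝒮, star (w S) * w' S := by
  rw [star_sum, sum_dotProduct]
  refine Finset.sum_congr rfl fun S hS => ?_
  rw [dotProduct_sum]
  have h : ∀ T ∈ 𝒮, star (w S • Pi.single (pairSet S S) (1 : ℂ)) ⬝ᵥ (w' T • Pi.single (pairSet T T) (1 : ℂ)) =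
      if S = T then star (w S) * w' T else 0 := by
    intro T _
    rw [star_smul, smul_dotProduct, dotProduct_smul, ← Pi.single_star, star_one, single_dotProduct, one_mul,
      Pi.single_apply, smul_eq_mul, smul_eq_mul]
    by_cases hST : S = T
    · subst hST
      rw [if_pos rfl, if_pos rfl, mul_one]
    · rw [if_neg (fun h => hST (pairSet_injective h).1), if_neg hST, mul_zero, mul_zero]
  rw [Finset.sum_congr rfl h, Finset.sum_ite_eq, if_pos hS]

/-- **Bond pair order of a doublon sum is `O(n)`.** For `g 0 = 0`, `L ≥ 2`:
`Re⟨ψ_w, Δ_gᴴΔ_g ψ_w⟩ ≤ 2 C_g² Σ_{S ∈ 𝒮} #S ‖w_S‖²`, `ψ_w = Σ_{S ∈ 𝒮} w_S |S↑∪S↓⟩` (disjoint supports reduce to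
single configurations). Scalapino, Phys. Rep. 250 (1995) 329, §2. [folklore] -/
theorem re_expect_pairField_doublonSum_le [Fact (1 < L)] {g : Site 2 → ℝ} (hg : g 0 = 0)
    (𝒮 : Finset (Finset (FermionTorus 2 L))) (w : Finset (FermionTorus 2 L) → ℂ) :
    (expect ((pairField g L)ᴴ * pairField g L) (∑ S ∈ 𝒮, w S • Pi.single (pairSet S S) (1 : ℂ))).re ≤
      2 * (∑ e ∈ insert 0 unitSteps, ‖((g e / Real.sqrt 2 : ℝ) : ℂ)‖ * 2) ^ 2 *
        ∑ S ∈ 𝒮, (S.card : ℝ) * ‖w S‖ ^ 2 := by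
  rw [PosSemidefTrace.expect_conjTranspose_mul, re_star_dotProduct_self]
  have hnn : ∀ u, ∀ S ∈ 𝒮, 0 ≤ ‖w S‖ ^ 2 * ‖(pairField g L *ᵥ Pi.single (pairSet S S) (1 : ℂ)) u‖ ^ 2 :=
    fun _ _ _ => by positivity
  have hpt : ∀ u, ‖(pairField g L *ᵥ ∑ S ∈ 𝒮, w S • Pi.single (pairSet S S) (1 : ℂ)) u‖ ^ 2 ≤
      ∑ S ∈ 𝒮, ‖w S‖ ^ 2 * ‖(pairField g L *ᵥ Pi.single (pairSet S S) (1 : ℂ)) u‖ ^ 2 := by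
    intro u
    rw [pairField_mulVec_doublonSum_apply hg 𝒮 w u]
    by_cases hu : (u.image fun o => (ofLex o).1) ∈ 𝒮
    · rw [if_pos hu, norm_mul, mul_pow]
      exact Finset.single_le_sum (hnn u) hu
    · rw [if_neg hu, norm_zero, zero_pow two_ne_zero]
      exact Finset.sum_nonneg (hnn u)
  have hS : ∀ S ∈ 𝒮, ‖w S‖ ^ 2 * ∑ u, ‖(pairField g L *ᵥ Pi.single (pairSet S S) (1 : ℂ)) u‖ ^ 2 ≤
      ‖w S‖ ^ 2 * (2 * (∑ e ∈ insert 0 unitSteps, ‖((g e / Real.sqrt 2 : ℝ) : ℂ)‖ * 2) ^ 2 * (S.card : ℝ)) :=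
    fun S _ => mul_le_mul_of_nonneg_left (sum_norm_sq_pairField_mulVec_single_pairSet_le hg S) (by positivity)
  have step1 : ∑ u, ‖(pairField g L *ᵥ ∑ S ∈ 𝒮, w S • Pi.single (pairSet S S) (1 : ℂ)) u‖ ^ 2 ≤
      ∑ u, ∑ S ∈ 𝒮, ‖w S‖ ^ 2 * ‖(pairField g L *ᵥ Pi.single (pairSet S S) (1 : ℂ)) u‖ ^ 2 :=
    Finset.sum_le_sum fun u _ => hpt u
  have step2 : ∑ u, ∑ S ∈ 𝒮, ‖w S‖ ^ 2 * ‖(pairField g L *ᵥ Pi.single (pairSet S S) (1 : ℂ)) u‖ ^ 2 =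
      ∑ S ∈ 𝒮, ‖w S‖ ^ 2 * ∑ u, ‖(pairField g L *ᵥ Pi.single (pairSet S S) (1 : ℂ)) u‖ ^ 2 := by
    rw [Finset.sum_comm]
    refine Finset.sum_congr rfl fun S _ => ?_
    rw [Finset.mul_sum]
  have step3 : ∑ S ∈ 𝒮, ‖w S‖ ^ 2 * ∑ u, ‖(pairField g L *ᵥ Pi.single (pairSet S S) (1 : ℂ)) u‖ ^ 2 ≤
      ∑ S ∈ 𝒮, ‖w S‖ ^ 2 *
        (2 * (∑ e ∈ insert 0 unitSteps, ‖((g e / Real.sqrt 2 : ℝ) : ℂ)‖ * 2) ^ 2 * (S.card : ℝ)) :=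
    Finset.sum_le_sum hS
  have step4 : ∑ S ∈ 𝒮, ‖w S‖ ^ 2 *
        (2 * (∑ e ∈ insert 0 unitSteps, ‖((g e / Real.sqrt 2 : ℝ) : ℂ)‖ * 2) ^ 2 * (S.card : ℝ)) =
      2 * (∑ e ∈ insert 0 unitSteps, ‖((g e / Real.sqrt 2 : ℝ) : ℂ)‖ * 2) ^ 2 *
        ∑ S ∈ 𝒮, (S.card : ℝ) * ‖w S‖ ^ 2 := by
    rw [Finset.mul_sum]
    refine Finset.sum_congr rfl fun S _ => ?_
    rw [mul_comm, mul_assoc]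
  exact (step1.trans_eq step2).trans (step3.trans_eq step4)

end BondBound

end Summit.HubbardSuperconductivity.HubbardSuperconductivity.Theorems.DWavePolarisedDiscordance.Negative

end
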